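import Mathlib
import Summits.Ventures.PercRepro2.HCov
import Summits.Ventures.PercRepro2.A3Inactive
import Summits.Ventures.PercRepro2.EdgeCubic
import Summits.Ventures.PercRepro2.PendantA3Pins
import Summits.Ventures.PercRepro2.PendantA3Masses
import Summits.Ventures.PercRepro2.PendantBSideBound

/-!
# The pendant `a₃` at any vertex `u`: the quadratic law of the weighted Bernstein coefficients,
(HCOV) at the closed pin outright, and the closure modulo the middle coefficient
(blind cell PercRepro2, mine-2 g56, 2026-08-30; `conjectures/MINE-2.md` M2-123)

Let `a₃` be a LEAF attached to `u` by the edge `f` (`hf`, `hleaf`), `t = p f`.  With `EdgeLine.B1`,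
`EdgeLine.B2` the one-edge Bernstein coefficients (`Gc_pin_cubic`) and `Gc₀ = Gc p[f↦0]`,
`Gc₁ = Gc p[f↦1]`:

* **`Gc_update_one_pendant`**: `Gc₁` is the (HCOV) form of the MERGED instance `a₃ := u`
  (`Gc p ends o a₁ a₂ u b`), so `HCov p[f↦1] ↔ HCov` of the merged instance;
* **`Gc_update_zero_pendant`**: `Gc₀ = 2P(Q)·[(Lb·Ho − P·HoLb) + (Hb·Lo − P·LoHb)]` — the
  `a₃`-inactive value — hence **`HCov_update_zero_pendant`**: (HCOV) at the closed pin holds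
  OUTRIGHT (BHK06 Thm 1.4 twice, `cross_whole` / `cross_whole_mirror`);
* **`quadratic_law`**: `B1 − Gc₀ = B2 − Gc₁` — the kernel `K₃` carries `a₃` in at most two of the
  three copies (night-3 g6's `typedCount_pendant_a3_quadratic` in the weighted vocabulary), so with
  `W := B1 − Gc₀` the one-edge cubic is the QUADRATIC `Gc p = (1 − t)²·Gc₀ + t(1 − t)·W + t²·Gc₁`
  (**`Gc_pendant_quadratic`**);
* **`HCov_pendant_of_W`**: (HCOV) on the merged instance and `0 ≤ B1 − Gc₀` give (HCOV) at `p` —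
  the last pendant of the weighted table reduces to the ONE-COPY statement `W ≥ 0` on the base graph
  with the five marks `(a₁, a₂, o, b, u)` (census-true: 0 negatives in 8,640 exact-rechecked climbs).
Own work; standard axioms.
-/

namespace Summit.Ventures.PercRepro2

namespace PendantA3

open CovForm CovForm.EdgeLine CovForm.SideBound

section Main

variable {V : Type*} {E : Type*} [Fintype E] [DecidableEq E] [Fintype V] [DecidableEq V]
  {R : Type*} [Field R] [LinearOrder R] [IsStrictOrderedRing R]

omit [Fintype V] [DecidableEq V] in
/-- **The open pin is the merged instance**: `Gc p[f↦1] = Gc p` with `a₃ := u`. -/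
theorem Gc_update_one_pendant (p : E → R) {ends : E → Sym2 V} {f : E} {o a₁ a₂ a₃ b u : V}
    (hf : ends f = s(a₃, u)) (hleaf : ∀ e, a₃ ∈ ends e → e = f) (h3u : a₃ ≠ u) (h13 : a₁ ≠ a₃)
    (h23 : a₂ ≠ a₃) (ho3 : o ≠ a₃) (hb3 : b ≠ a₃) :
    Gc (Function.update p f 1) ends o a₁ a₂ a₃ b = Gc p ends o a₁ a₂ u b := by
  obtain ⟨hQ, hD, hDo, hEQbo, hEQb3, hEQb3o, hEQo, hEQ3, hEQ3o, hPDb, hPDbo, hgap⟩ :=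
    pins_one_pendant p hf hleaf h3u h13 h23 ho3 hb3
  rw [Gc_eq_GcPoly, Gc_eq_GcPoly, hQ, hD, hDo, hEQbo, hEQb3, hEQb3o, hEQo, hEQ3, hEQ3o, hPDb,
    hPDbo, hgap]

omit [Fintype V] [DecidableEq V] in
/-- **The closed pin is the `a₃`-inactive value**:
`Gc p[f↦0] = 2P(Q)·[(P(Q,lb)P(Q,ho) − P(Q)P(Q,ho,lb)) + (P(Q,hb)P(Q,lo) − P(Q)P(Q,lo,hb))]`. -/
theorem Gc_update_zero_pendant (p : E → R) {ends : E → Sym2 V} {f : E} {o a₁ a₂ a₃ b u : V}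
    (hf : ends f = s(a₃, u)) (hleaf : ∀ e, a₃ ∈ ends e → e = f) (h3u : a₃ ≠ u) (h13 : a₁ ≠ a₃)
    (h23 : a₂ ≠ a₃) (ho3 : o ≠ a₃) (hb3 : b ≠ a₃) :
    Gc (Function.update p f 0) ends o a₁ a₂ a₃ b =
      2 * prob p (avoidAll ends a₂ {a₁}) *
        ((prob p (avoidAll ends a₂ {a₁} ∩ connEvent ends a₁ b) *
            prob p (avoidAll ends a₂ {a₁} ∩ connEvent ends a₂ o) -
          prob p (avoidAll ends a₂ {a₁}) *
            prob p (avoidAll ends a₂ {a₁} ∩ (connEvent ends a₂ o ∩ connEvent ends a₁ b))) +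
         (prob p (avoidAll ends a₂ {a₁} ∩ connEvent ends a₂ b) *
            prob p (avoidAll ends a₂ {a₁} ∩ connEvent ends a₁ o) -
          prob p (avoidAll ends a₂ {a₁}) *
            prob p (avoidAll ends a₂ {a₁} ∩ (connEvent ends a₁ o ∩ connEvent ends a₂ b)))) := by
  obtain ⟨hQ, hD, hDo, hEQbo, hEQb3, hEQb3o, hEQo, hEQ3, hEQ3o, hPDb, hPDbo, hgap⟩ :=
    pins_zero_pendant p hf hleaf h3u h13 h23 ho3 hb3
  rw [Gc_eq_GcPoly, hQ, hD, hDo, hEQbo, hEQb3, hEQb3o, hEQo, hEQ3, hEQ3o, hPDb, hPDbo, hgap]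
  unfold GcPoly EQbo EQo
  rw [gap_eq_Q]
  ring

/-- **(HCOV) at the closed pin holds outright** (BHK06 Thm 1.4 twice). -/
theorem HCov_update_zero_pendant (p : E → R) (hp : IsProbVec p) {ends : E → Sym2 V} {f : E}
    {o a₁ a₂ a₃ b u : V} (hf : ends f = s(a₃, u)) (hleaf : ∀ e, a₃ ∈ ends e → e = f)
    (h3u : a₃ ≠ u) (h13 : a₁ ≠ a₃) (h23 : a₂ ≠ a₃) (ho3 : o ≠ a₃) (hb3 : b ≠ a₃) :
    HCov (Function.update p f 0) ends o a₁ a₂ a₃ b := by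
  unfold HCov
  rw [Gc_update_zero_pendant p hf hleaf h3u h13 h23 ho3 hb3]
  have h1 := cross_whole p hp ends o a₁ a₂ b
  have h2 := cross_whole_mirror p hp ends o a₁ a₂ b
  have hQ := prob_nonneg hp (avoidAll ends a₂ {a₁})
  have e1 : 0 ≤ prob p (avoidAll ends a₂ {a₁} ∩ connEvent ends a₁ b) *
      prob p (avoidAll ends a₂ {a₁} ∩ connEvent ends a₂ o) -
      prob p (avoidAll ends a₂ {a₁}) *
        prob p (avoidAll ends a₂ {a₁} ∩ (connEvent ends a₂ o ∩ connEvent ends a₁ b)) := by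
    nlinarith [h2]
  have e2 : 0 ≤ prob p (avoidAll ends a₂ {a₁} ∩ connEvent ends a₂ b) *
      prob p (avoidAll ends a₂ {a₁} ∩ connEvent ends a₁ o) -
      prob p (avoidAll ends a₂ {a₁}) *
        prob p (avoidAll ends a₂ {a₁} ∩ (connEvent ends a₁ o ∩ connEvent ends a₂ b)) := by
    nlinarith [h1]
  have := add_nonneg e1 e2
  positivity

omit [Fintype V] [DecidableEq V] in
/-- **The quadratic law**: at a pendant edge of `a₃`, `B1 − Gc₀ = B2 − Gc₁` — every monomial of
`Gc` carries at most two `a₃`-dependent factors, so the polarised forms agree after subtracting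
the pins. -/
theorem quadratic_law (p : E → R) {ends : E → Sym2 V} {f : E} {o a₁ a₂ a₃ b u : V}
    (hf : ends f = s(a₃, u)) (hleaf : ∀ e, a₃ ∈ ends e → e = f) (h3u : a₃ ≠ u) (h13 : a₁ ≠ a₃)
    (h23 : a₂ ≠ a₃) (ho3 : o ≠ a₃) (hb3 : b ≠ a₃) :
    B1 p ends o a₁ a₂ a₃ b f - Gc (Function.update p f 0) ends o a₁ a₂ a₃ b =
      B2 p ends o a₁ a₂ a₃ b f - Gc (Function.update p f 1) ends o a₁ a₂ a₃ b := by
  obtain ⟨hQ0, hD0, hDo0, hEQbo0, hEQb30, hEQb3o0, hEQo0, hEQ30, hEQ3o0, hPDb0, hPDbo0, hgap0⟩ :=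
    pins_zero_pendant p hf hleaf h3u h13 h23 ho3 hb3
  obtain ⟨hQ1, hD1, hDo1, hEQbo1, hEQb31, hEQb3o1, hEQo1, hEQ31, hEQ3o1, hPDb1, hPDbo1, hgap1⟩ :=
    pins_one_pendant p hf hleaf h3u h13 h23 ho3 hb3
  unfold B1 B2
  rw [Gc_eq_GcPoly, Gc_eq_GcPoly, hQ0, hD0, hDo0, hEQbo0, hEQb30, hEQb3o0, hEQo0, hEQ30, hEQ3o0,
    hPDb0, hPDbo0, hgap0, hQ1, hD1, hDo1, hEQbo1, hEQb31, hEQb3o1, hEQo1, hEQ31, hEQ3o1, hPDb1,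
    hPDbo1, hgap1]
  unfold B1Poly B2Poly GcPoly polar1 polar2
  ring

omit [Fintype V] [DecidableEq V] in
/-- **The one-edge cubic at a pendant `a₃` is a quadratic**:
`Gc p = (1 − t)²·Gc₀ + t(1 − t)·(B1 − Gc₀) + t²·Gc₁`. -/
theorem Gc_pendant_quadratic (p : E → R) {ends : E → Sym2 V} {f : E} {o a₁ a₂ a₃ b u : V}
    (hf : ends f = s(a₃, u)) (hleaf : ∀ e, a₃ ∈ ends e → e = f) (h3u : a₃ ≠ u) (h13 : a₁ ≠ a₃)
    (h23 : a₂ ≠ a₃) (ho3 : o ≠ a₃) (hb3 : b ≠ a₃) :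
    Gc p ends o a₁ a₂ a₃ b =
      (1 - p f) ^ 2 * Gc (Function.update p f 0) ends o a₁ a₂ a₃ b +
        p f * (1 - p f) * (B1 p ends o a₁ a₂ a₃ b f - Gc (Function.update p f 0) ends o a₁ a₂ a₃ b) +
        (p f) ^ 2 * Gc (Function.update p f 1) ends o a₁ a₂ a₃ b := by
  have hq := quadratic_law p hf hleaf h3u h13 h23 ho3 hb3
  rw [Gc_pin_cubic p ends o a₁ a₂ a₃ b f]
  have hB2 : B2 p ends o a₁ a₂ a₃ b f = B1 p ends o a₁ a₂ a₃ b f -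
      Gc (Function.update p f 0) ends o a₁ a₂ a₃ b + Gc (Function.update p f 1) ends o a₁ a₂ a₃ b := by
    linarith
  rw [hB2]
  ring

/-- **The last pendant modulo its middle coefficient**: at a pendant edge `f` of `a₃` with
attachment vertex `u`, (HCOV) on the MERGED instance (`a₃ := u`) and `0 ≤ B1 − Gc p[f↦0]` give
(HCOV) at `p`; the closed pin is a theorem (`HCov_update_zero_pendant`). -/
theorem HCov_pendant_of_W (p : E → R) (hp : IsProbVec p) {ends : E → Sym2 V} {f : E}
    {o a₁ a₂ a₃ b u : V} (hf : ends f = s(a₃, u)) (hleaf : ∀ e, a₃ ∈ ends e → e = f)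
    (h3u : a₃ ≠ u) (h13 : a₁ ≠ a₃) (h23 : a₂ ≠ a₃) (ho3 : o ≠ a₃) (hb3 : b ≠ a₃)
    (h₁ : HCov p ends o a₁ a₂ u b)
    (hW : 0 ≤ B1 p ends o a₁ a₂ a₃ b f - Gc (Function.update p f 0) ends o a₁ a₂ a₃ b) :
    HCov p ends o a₁ a₂ a₃ b := by
  have h₀ := HCov_update_zero_pendant p hp hf hleaf h3u h13 h23 ho3 hb3
  have h₁' : HCov (Function.update p f 1) ends o a₁ a₂ a₃ b := by
    unfold HCov
    rw [Gc_update_one_pendant p hf hleaf h3u h13 h23 ho3 hb3]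
    exact h₁
  have hq := quadratic_law p hf hleaf h3u h13 h23 ho3 hb3
  refine HCov_of_update_zero_of_bern p hp ends o a₁ a₂ a₃ b f h₀ h₁' ?_ ?_
  · unfold HCov at h₀; linarith
  · unfold HCov at h₁'; linarith

end Main

end PendantA3

end Summit.Ventures.PercRepro2
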